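import Mathlib.MeasureTheory.Integral.Bochner.Set
import Mathlib.MeasureTheory.Measure.Real
import Mathlib.MeasureTheory.Measure.Typeclasses.Probability

/-!
# Layer cake for integer-valued observables with small atoms

Helper for stub `stub_spreadFromParts` (S6) of line `free-volume-heavy-witness`
(crux `Summit.QuantumFields.QCD.Theses.SpectralDefectExtinction.WindowExtinction`,
item stmt-QuantumFields-8964).

On a probability space, an integrable `ℤ`-valued observable `X` all of whose atoms have
probability `≤ 1/4` has first absolute moment at least `1`:
`E|X| ≥ P(X ≠ 0) + P(|X| ≥ 2) ≥ (1 - 1/4) + (1 - 3/4) = 1`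
(`spread_one_le_integral_abs_of_atom_le`).  Pure measure theory, no project vocabulary.
-/

noncomputable section

namespace Summit.QuantumFields.QCD.Cruxes.WindowExtinction.FreeVolumeHeavyWitness

open MeasureTheory Set
open scoped ENNReal

variable {α : Type*} [MeasurableSpace α]

/-- Pointwise layer cake for integers: `[x ≠ 0] + [2 ≤ |x|] ≤ |x|`. -/
theorem spread_layerCake_pointwise (x : ℤ) :
    (if x ≠ 0 then (1 : ℝ) else 0) + (if (2 : ℤ) ≤ |x| then (1 : ℝ) else 0) ≤ |(x : ℝ)| := by
  have hcast : |(x : ℝ)| = ((|x| : ℤ) : ℝ) := Int.cast_abs.symm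
  rw [hcast]
  by_cases h0 : x = 0
  · subst h0; norm_num
  · have h1 : (1 : ℤ) ≤ |x| := Int.one_le_abs h0
    by_cases h2 : (2 : ℤ) ≤ |x|
    · rw [if_pos h0, if_pos h2]
      have : (2 : ℝ) ≤ ((|x| : ℤ) : ℝ) := by exact_mod_cast h2
      linarith
    · rw [if_pos h0, if_neg h2]
      have : (1 : ℝ) ≤ ((|x| : ℤ) : ℝ) := by exact_mod_cast h1
      linarith

/-- An atom bound `P {X = j} ≤ 1/4` in `ℝ≥0∞` read in `ℝ`. -/
theorem spread_real_atom_le (P : Measure α) [IsProbabilityMeasure P] {X : α → ℤ}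
    (h : ∀ j : ℤ, P {a | X a = j} ≤ 4⁻¹) (j : ℤ) : P.real {a | X a = j} ≤ 1 / 4 := by
  have h1 : (P {a | X a = j}).toReal ≤ (4⁻¹ : ℝ≥0∞).toReal :=
    ENNReal.toReal_mono (ENNReal.inv_ne_top.2 (by norm_num)) (h j)
  rw [ENNReal.toReal_inv] at h1
  simpa [measureReal_def] using h1

/-- **Layer cake.** On a probability space, an integrable integer-valued measurable `X` whose
atoms all have probability at most `1/4` satisfies `1 ≤ ∫ |X|`:
`∫ |X| ≥ P(X ≠ 0) + P(|X| ≥ 2)`, `P(X ≠ 0) = 1 - P(X = 0) ≥ 3/4`, and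
`P(|X| ≥ 2) = 1 - P(X ∈ {-1, 0, 1}) ≥ 1/4`. -/
theorem spread_one_le_integral_abs_of_atom_le :
    ∀ {α : Type*} [MeasurableSpace α] (P : Measure α) [IsProbabilityMeasure P] {X : α → ℤ},
      Measurable X → Integrable (fun a => (X a : ℝ)) P → (∀ j : ℤ, P {a | X a = j} ≤ 4⁻¹) →
        1 ≤ ∫ a, |(X a : ℝ)| ∂P := by
  intro α _ P _ X hX hint h
  -- the two level sets
  set S₁ : Set α := {a | X a ≠ 0} with hS₁
  set S₂ : Set α := {a | (2 : ℤ) ≤ |X a|} with hS₂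
  have hmS : ∀ j : ℤ, MeasurableSet {a | X a = j} := fun j =>
    hX (measurableSet_singleton j)
  have hmS₁ : MeasurableSet S₁ := (hmS 0).compl
  have habs : Measurable fun a => |X a| := (measurable_from_top (f := fun z : ℤ => |z|)).comp hX
  have hmS₂ : MeasurableSet S₂ := habs measurableSet_Ici
  -- the indicator sum is below `|X|`
  have hle : ∀ a, S₁.indicator (1 : α → ℝ) a + S₂.indicator (1 : α → ℝ) a ≤ |(X a : ℝ)| := by
    intro a
    have h1 : S₁.indicator (1 : α → ℝ) a = if X a ≠ 0 then (1 : ℝ) else 0 := by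
      simp only [indicator, hS₁, mem_setOf_eq, Pi.one_apply]
    have h2 : S₂.indicator (1 : α → ℝ) a = if (2 : ℤ) ≤ |X a| then (1 : ℝ) else 0 := by
      simp only [indicator, hS₂, mem_setOf_eq, Pi.one_apply]
    rw [h1, h2]
    exact spread_layerCake_pointwise (X a)
  have hi₁ : Integrable (S₁.indicator (1 : α → ℝ)) P :=
    (integrable_const (1 : ℝ)).indicator hmS₁
  have hi₂ : Integrable (S₂.indicator (1 : α → ℝ)) P :=
    (integrable_const (1 : ℝ)).indicator hmS₂
  have hmono : ∫ a, (S₁.indicator (1 : α → ℝ) a + S₂.indicator (1 : α → ℝ) a) ∂P ≤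
      ∫ a, |(X a : ℝ)| ∂P :=
    integral_mono (hi₁.add hi₂) hint.abs hle
  rw [integral_add hi₁ hi₂, integral_indicator_one hmS₁, integral_indicator_one hmS₂] at hmono
  -- `P(X ≠ 0) ≥ 3/4`
  have hP₁ : 3 / 4 ≤ P.real S₁ := by
    have : P.real S₁ = 1 - P.real {a | X a = 0} := by
      rw [hS₁]
      exact probReal_compl_eq_one_sub (hmS 0)
    rw [this]
    linarith [spread_real_atom_le P h 0]
  -- `P(|X| ≥ 2) ≥ 1/4`
  have hP₂ : 1 / 4 ≤ P.real S₂ := by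
    have hsub : S₂ᶜ ⊆ ({a | X a = -1} ∪ {a | X a = 0}) ∪ {a | X a = 1} := by
      intro a ha
      simp only [hS₂, mem_compl_iff, mem_setOf_eq, not_le] at ha
      simp only [mem_union, mem_setOf_eq]
      have h3 := abs_lt.1 ha
      omega
    have hc : P.real S₂ᶜ = 1 - P.real S₂ := probReal_compl_eq_one_sub hmS₂
    have hle3 : P.real S₂ᶜ ≤ 3 / 4 :=
      calc P.real S₂ᶜ ≤ P.real (({a | X a = -1} ∪ {a | X a = 0}) ∪ {a | X a = 1}) :=
            measureReal_mono hsub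
        _ ≤ P.real ({a | X a = -1} ∪ {a | X a = 0}) + P.real {a | X a = 1} :=
            measureReal_union_le _ _
        _ ≤ (P.real {a | X a = -1} + P.real {a | X a = 0}) + P.real {a | X a = 1} :=
            add_le_add_left (measureReal_union_le _ _) _
        _ ≤ (1 / 4 + 1 / 4) + 1 / 4 :=
            add_le_add (add_le_add (spread_real_atom_le P h _) (spread_real_atom_le P h _))
              (spread_real_atom_le P h _)
        _ = 3 / 4 := by norm_num
    linarith
  linarith

end Summit.QuantumFields.QCD.Cruxes.WindowExtinction.FreeVolumeHeavyWitness

end
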